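import Mathlib
import HarnessLib
import Summits.HubbardSuperconductivity.HubbardSuperconductivity.Theorems.KLProgrammeKLRegimeVolumeLimitNestedPoisson
import Literature.MathematicalPhysics.QuantumLattice.FramePosKernelL1

/-!
# Periodisation of translation-invariant kernels between NESTED tori `(ℤ/Mℤ)^d → (ℤ/mℤ)^d`, `M = b·m`:
# sampled-symbol kernels periodise EXACTLY, convolution commutes with periodisation, and a closed loop errs by WINDINGS
# (cell gate-hubbard-kl, seat hubbard-kl-k3c4-p1 g6, technique «FST2 volume lemmas»; VL-E3F-ROADMAP §3 (P1)–(P4); `--supports` the VL / engine items)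

The finite-size mechanism behind the nested two-volume legs of (E3f-A) `TwoLegVolumeRateA` and of `stub_vl_carrierRate` (BGM 2006 §2.3 fn. 1;
Friedli–Velenik §10.4): with the reduction `red : (ℤ/Mℤ)^d → (ℤ/mℤ)^d`, `x ↦ (x_i.val : ℤ/m)` (written inline, as in `…VolumeLimitNestedPoisson`) and
the periodisation `(Per g)(x̄) = Σ_{red y = x̄} g y` (written inline as a filtered sum),

* §1 `red` is additive (`m ∣ M`: it is `ZMod.castHom`), fibres translate;
* §2 **sampled-symbol kernels periodise exactly** (`periodise_torusFourierInv_sampled`): for ANY symbol `f : (Fin d → ℝ) → ℂ`,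
  `Per (x ↦ M^{-d} Σ_{k fine} f(p_k) χ_k(x)) = (x̄ ↦ m^{-d} Σ_{k' coarse} f(p_{k'}) χ_{k'}(x̄))` — every torus covariance / slice of the programme is
  of this form (same symbol sampled on the two grids), so `C_m = Per C_M` with NO error (proof: k3c5-p3's Poisson identity p498107 + Fourier inversion);
* §3 **periodisation commutes with convolution** (`periodise_conv`): `Per (A ∗_M B) = (Per A) ∗_m (Per B)` — contraction along ONE site variable
  (hence along every TREE of lines) is exact;
* §4 **a closed loop errs by windings** (`coarse_loop_eq_fine_loop_add_windings`): `Σ_ȳ (Per A)(ȳ)(Per B)(−ȳ) = Σ_y A(y)B(−y) + Σ_{red z = 0, z ≠ 0} (A ∗_M B)(z)`,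
  with the triangle bound `norm_coarse_loop_sub_fine_loop_le` — the only place a two-volume comparison pays, and it pays in the DECAY of `A ∗ B` at
  fine displacements in `ker red ∖ {0}` (sup-distance `≥ m`);
* §5 (appended) **windings are far and their sum is one weighted norm away**: `m ≤ Torus.tnorm z` on `ker red ∖ {0}` (`le_tnorm_of_reduce_eq_zero`),
  `Σ_{windings} ‖F‖ ≤ (Σ_z w(tnorm z)‖F z‖) / w(m)` for any monotone non-negative weight (`sum_windings_norm_le_of_weighted`), hence the loop error
  `≤ N / w(m)` (`norm_coarse_loop_sub_fine_loop_le_of_weighted`) — the programme's weighted `L¹` norms of the slices/kernels are exactly such `N`;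
* §6 (appended) the `torusFourier` (minus-sign) convention (`periodise_torusFourier_sampled`) and the model instance **`periodise_framePosKernel`**:
  the frame's position kernel `Ǩ_L = L⁻²·(K ∘ p)^` of the coarse torus IS the periodisation of the fine one (the counterterm vertex is volume-exact);
* §7 (appended) `tnorm_reduce_le` (the reduction does not increase torus distance) and `weighted_norm_periodise_le`: periodisation does not increase
  `ℓ¹` norms weighted by any monotone function of the torus distance (the coarse theory's periodised inputs inherit the fine theory's weighted bounds).

Everything is proved; no definition (reduction, periodisation and convolution are written inline); nothing is asserted about the model.
References: S. Friedli, Y. Velenik, *Statistical Mechanics of Lattice Systems* (CUP 2017) §10.4; G. Benfatto, A. Giuliani, V. Mastropietro, Ann. H.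
Poincaré 7 (2006) §2.3 fn. 1.
-/

noncomputable section

namespace Summit.HubbardSuperconductivity.HubbardSuperconductivity.Theorems.TwoPointAssembly

set_option linter.dupNamespace false -- summit = problem name (single-conjunct summit), D-0017

open Finset Complex Literature.MathematicalPhysics.QuantumLattice Literature.Probability.LatticeModels
open scoped ComplexConjugate

section Nested

variable {d b m M : ℕ} [NeZero M] [NeZero m]

/-! ## §1 The reduction map is additive; fibres translate -/

omit [NeZero M] [NeZero m] in
/-- `M = b·m ⇒ m ∣ M`. [folklore] -/
theorem dvd_of_eq_mul (hM : M = b * m) : m ∣ M := ⟨b, by rw [hM, mul_comm]⟩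

omit [NeZero m] in
/-- The inline reduction `x ↦ (x_i.val : ℤ/m)` is `ZMod.castHom`. [folklore] -/
theorem reduce_eq_castHom (hM : M = b * m) (x : TorusSite d M) :
    (fun i => (((x i).val : ℕ) : ZMod m)) = fun i => ZMod.castHom (dvd_of_eq_mul hM) (ZMod m) (x i) := by
  funext i; rw [ZMod.castHom_apply, ZMod.cast_eq_val]

omit [NeZero m] in
/-- The reduction is additive. [folklore] -/
theorem reduce_add (hM : M = b * m) (x y : TorusSite d M) :
    (fun i => ((((x + y) i).val : ℕ) : ZMod m)) = (fun i => (((x i).val : ℕ) : ZMod m)) + fun i => (((y i).val : ℕ) : ZMod m) := by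
  rw [reduce_eq_castHom hM, reduce_eq_castHom hM, reduce_eq_castHom hM]
  funext i; simp [Pi.add_apply, map_add]

omit [NeZero m] in
/-- The reduction commutes with negation. [folklore] -/
theorem reduce_neg (hM : M = b * m) (x : TorusSite d M) :
    (fun i => ((((-x) i).val : ℕ) : ZMod m)) = -fun i => (((x i).val : ℕ) : ZMod m) := by
  rw [reduce_eq_castHom hM, reduce_eq_castHom hM]
  funext i; simp [Pi.neg_apply, map_neg]

omit [NeZero m] in
/-- The reduction commutes with subtraction. [folklore] -/
theorem reduce_sub (hM : M = b * m) (x y : TorusSite d M) :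
    (fun i => ((((x - y) i).val : ℕ) : ZMod m)) = (fun i => (((x i).val : ℕ) : ZMod m)) - fun i => (((y i).val : ℕ) : ZMod m) := by
  rw [sub_eq_add_neg, reduce_add hM, reduce_neg hM, sub_eq_add_neg]

omit [NeZero M] [NeZero m] in
/-- The reduction of `0` is `0`. [folklore] -/
theorem reduce_zero : (fun i => ((((0 : TorusSite d M) i).val : ℕ) : ZMod m)) = 0 := by
  funext i; simp

/-- **Fibre sums as free sums**: `Σ_{x̄} Σ_{red y = x̄} F y = Σ_y F y`. [folklore] -/
theorem sum_sum_fibre (F : TorusSite d M → ℂ) :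
    ∑ x : TorusSite d m, ∑ y ∈ univ.filter (fun y : TorusSite d M => (fun i => (((y i).val : ℕ) : ZMod m)) = x), F y = ∑ y, F y := by
  classical
  exact Finset.sum_fiberwise univ (fun y : TorusSite d M => (fun i => (((y i).val : ℕ) : ZMod m))) F

omit [NeZero m] in
/-- **Fibres translate**: summing `G (z − y)` over the fibre of `z̄` is summing `G` over the fibre of `z̄ − red y`. [folklore] -/
theorem sum_fibre_sub_right (hM : M = b * m) (G : TorusSite d M → ℂ) (y : TorusSite d M) (zbar : TorusSite d m) :
    ∑ z ∈ univ.filter (fun z : TorusSite d M => (fun i => (((z i).val : ℕ) : ZMod m)) = zbar), G (z - y) =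
      ∑ w ∈ univ.filter (fun w : TorusSite d M => (fun i => (((w i).val : ℕ) : ZMod m)) = zbar - fun i => (((y i).val : ℕ) : ZMod m)), G w := by
  classical
  refine Finset.sum_bij' (fun z _ => z - y) (fun w _ => w + y) ?_ ?_ ?_ ?_ ?_
  · intro z hz
    simp only [mem_filter, mem_univ, true_and] at hz ⊢
    rw [reduce_sub hM, hz]
  · intro w hw
    simp only [mem_filter, mem_univ, true_and] at hw ⊢
    rw [reduce_add hM, hw, sub_add_cancel]
  · intro z _; simp
  · intro w _; simp
  · intro z _; rfl

/-! ## §2 Sampled-symbol kernels periodise EXACTLY (`C_m = Per C_M`) -/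

/-- **The same symbol sampled on the two grids periodises exactly.**  For `M = b·m` and any `f : (Fin d → ℝ) → ℂ`, the fine kernel
`x ↦ M^{-d} Σ_k f(p_k) χ_k(x)` summed over the fibre of `x̄` is the coarse kernel `m^{-d} Σ_{k'} f(p_{k'}) χ_{k'}(x̄)` (Poisson p498107 read at the
lifted momenta, where `p_{b·k'} = p_{k'}`, + Fourier inversion).  Every translation-invariant torus covariance of the programme is of this form. [folklore] -/
theorem periodise_torusFourierInv_sampled (hM : M = b * m) (f : (Fin d → ℝ) → ℂ) (xbar : TorusSite d m) :
    ∑ y ∈ univ.filter (fun y : TorusSite d M => (fun i => (((y i).val : ℕ) : ZMod m)) = xbar),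
        torusFourierInv (fun k : TorusSite d M => f (latticeMomentum M k)) y =
      torusFourierInv (fun k : TorusSite d m => f (latticeMomentum m k)) xbar := by
  classical
  -- both sides have the same coarse Fourier transform
  set g : TorusSite d M → ℂ := torusFourierInv (fun k : TorusSite d M => f (latticeMomentum M k)) with hg
  set h : TorusSite d m → ℂ := fun xb =>
    ∑ y ∈ univ.filter (fun y : TorusSite d M => (fun i => (((y i).val : ℕ) : ZMod m)) = xb), g y with hh
  have hcoarse : torusFourier h = fun k : TorusSite d m => f (latticeMomentum m k) := by
    funext k
    rw [hh, ← torusFourier_lift_eq_torusFourier_periodise hM g k, hg,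
      torusFourier_torusFourierInv_holds (fun k : TorusSite d M => f (latticeMomentum M k))]
    simp only [latticeMomentum_lift hM k]
  have hinv := torusFourier_inversion_holds (d := d) (L := m) h
  rw [hcoarse] at hinv
  -- `h = torusFourierInv (f ∘ p)`
  have := congr_fun hinv xbar
  rw [this]

/-! ## §3 Periodisation commutes with convolution (trees are exact) -/

/-- **`Per (A ∗_M B) = (Per A) ∗_m (Per B)`**: periodising the fine convolution `z ↦ Σ_y A(y) B(z − y)` over the fibre of `z̄` gives the coarse
convolution of the periodised kernels.  Contraction along one site variable — hence along any tree of lines — commutes with periodisation EXACTLY.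
[folklore] -/
theorem periodise_conv (hM : M = b * m) (A B : TorusSite d M → ℂ) (zbar : TorusSite d m) :
    ∑ z ∈ univ.filter (fun z : TorusSite d M => (fun i => (((z i).val : ℕ) : ZMod m)) = zbar), ∑ y, A y * B (z - y) =
      ∑ ybar : TorusSite d m,
        (∑ y ∈ univ.filter (fun y : TorusSite d M => (fun i => (((y i).val : ℕ) : ZMod m)) = ybar), A y) *
        ∑ w ∈ univ.filter (fun w : TorusSite d M => (fun i => (((w i).val : ℕ) : ZMod m)) = zbar - ybar), B w := by
  classical
  rw [Finset.sum_comm]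
  simp_rw [← Finset.mul_sum]
  -- `Σ_y A y · Σ_{z ∈ fib z̄} B (z − y)` → translate the fibre, then group `y` by fibre
  have h1 : ∀ y : TorusSite d M,
      A y * ∑ z ∈ univ.filter (fun z : TorusSite d M => (fun i => (((z i).val : ℕ) : ZMod m)) = zbar), B (z - y) =
        A y * ∑ w ∈ univ.filter (fun w : TorusSite d M =>
          (fun i => (((w i).val : ℕ) : ZMod m)) = zbar - fun i => (((y i).val : ℕ) : ZMod m)), B w := fun y => by
    rw [sum_fibre_sub_right hM B y zbar]
  simp_rw [h1]
  rw [← sum_sum_fibre (m := m) (fun y => A y * ∑ w ∈ univ.filter (fun w : TorusSite d M =>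
      (fun i => (((w i).val : ℕ) : ZMod m)) = zbar - fun i => (((y i).val : ℕ) : ZMod m)), B w)]
  refine Finset.sum_congr rfl fun ybar _ => ?_
  rw [Finset.sum_mul]
  refine Finset.sum_congr rfl fun y hy => ?_
  rw [(Finset.mem_filter.1 hy).2]

/-! ## §4 A closed loop errs by windings -/

/-- **The coarse loop is the periodised fine convolution at the origin**: `Σ_ȳ (Per A)(ȳ)(Per B)(−ȳ) = Σ_{red z = 0} (A ∗_M B)(z)`. [folklore] -/
theorem coarse_loop_eq_periodise_conv_zero (hM : M = b * m) (A B : TorusSite d M → ℂ) :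
    ∑ ybar : TorusSite d m,
        (∑ y ∈ univ.filter (fun y : TorusSite d M => (fun i => (((y i).val : ℕ) : ZMod m)) = ybar), A y) *
        ∑ w ∈ univ.filter (fun w : TorusSite d M => (fun i => (((w i).val : ℕ) : ZMod m)) = -ybar), B w =
      ∑ z ∈ univ.filter (fun z : TorusSite d M => (fun i => (((z i).val : ℕ) : ZMod m)) = 0), ∑ y, A y * B (z - y) := by
  rw [periodise_conv hM A B 0]
  simp only [zero_sub]

/-- **Winding decomposition of the coarse loop**: `Σ_ȳ (Per A)(ȳ)(Per B)(−ȳ) = Σ_y A(y)B(−y) + Σ_{red z = 0, z ≠ 0} (A ∗_M B)(z)` — the fine loop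
plus the windings `z ∈ ker red ∖ {0}` (fine displacements by non-zero multiples of `m`). [folklore] -/
theorem coarse_loop_eq_fine_loop_add_windings (hM : M = b * m) (A B : TorusSite d M → ℂ) :
    ∑ ybar : TorusSite d m,
        (∑ y ∈ univ.filter (fun y : TorusSite d M => (fun i => (((y i).val : ℕ) : ZMod m)) = ybar), A y) *
        ∑ w ∈ univ.filter (fun w : TorusSite d M => (fun i => (((w i).val : ℕ) : ZMod m)) = -ybar), B w =
      (∑ y, A y * B (-y)) +
        ∑ z ∈ (univ.filter (fun z : TorusSite d M => (fun i => (((z i).val : ℕ) : ZMod m)) = 0)).erase 0, ∑ y, A y * B (z - y) := by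
  classical
  rw [coarse_loop_eq_periodise_conv_zero hM]
  have h0 : (0 : TorusSite d M) ∈ univ.filter (fun z : TorusSite d M => (fun i => (((z i).val : ℕ) : ZMod m)) = 0) :=
    Finset.mem_filter.2 ⟨Finset.mem_univ _, reduce_zero⟩
  rw [← Finset.add_sum_erase _ _ h0]
  simp only [zero_sub]

/-- **The two-volume loop error is the windings' size**: `‖Σ_ȳ (Per A)(ȳ)(Per B)(−ȳ) − Σ_y A(y)B(−y)‖ ≤ Σ_{red z = 0, z ≠ 0} ‖(A ∗_M B)(z)‖`.
[folklore] -/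
theorem norm_coarse_loop_sub_fine_loop_le (hM : M = b * m) (A B : TorusSite d M → ℂ) :
    ‖(∑ ybar : TorusSite d m,
        (∑ y ∈ univ.filter (fun y : TorusSite d M => (fun i => (((y i).val : ℕ) : ZMod m)) = ybar), A y) *
        ∑ w ∈ univ.filter (fun w : TorusSite d M => (fun i => (((w i).val : ℕ) : ZMod m)) = -ybar), B w) -
      ∑ y, A y * B (-y)‖ ≤
      ∑ z ∈ (univ.filter (fun z : TorusSite d M => (fun i => (((z i).val : ℕ) : ZMod m)) = 0)).erase 0, ‖∑ y, A y * B (z - y)‖ := by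
  rw [coarse_loop_eq_fine_loop_add_windings hM, add_sub_cancel_left]
  exact norm_sum_le _ _

omit [NeZero M] [NeZero m] in
/-- **Windings are far**: a non-zero fine site reducing to `0` has a coordinate whose representative is a NON-ZERO multiple of `m` — so every winding
displacement has sup-norm at least `m` in `{0,…,M−1}` coordinates (the decay of `A ∗ B` beyond distance `m` controls §4's error). [folklore] -/
theorem exists_val_eq_mul_of_reduce_eq_zero {z : TorusSite d M}
    (hz : (fun i => (((z i).val : ℕ) : ZMod m)) = 0) (hz0 : z ≠ 0) :
    ∃ i : Fin d, ∃ t : ℕ, 1 ≤ t ∧ (z i).val = m * t := by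
  obtain ⟨i, hi⟩ : ∃ i, z i ≠ 0 := by
    by_contra h
    exact hz0 (funext fun i => not_not.mp (not_exists.mp h i))
  have hred : (((z i).val : ℕ) : ZMod m) = 0 := congr_fun hz i
  rw [ZMod.natCast_eq_zero_iff] at hred
  obtain ⟨t, ht⟩ := hred
  refine ⟨i, t, ?_, ht⟩
  rcases Nat.eq_zero_or_pos t with h0 | hpos
  · exfalso
    apply hi
    have : (z i).val = 0 := by rw [ht, h0, mul_zero]
    exact (ZMod.val_eq_zero (z i)).1 this
  · exact hpos


/-! ## §5 Windings are at torus distance `≥ m`; the winding sum is controlled by any monotone decay weight -/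

omit [NeZero m] in
/-- A residue of `ℤ/Mℤ` whose representative is a non-zero multiple `m·t` of `m` (`M = b·m`, hence `t < b`) has centred representative of size
`≥ m`: `m ≤ |cRepZ a|`. [folklore] -/
theorem le_natAbs_cRepZ_of_val_eq_mul (hM : M = b * m) {a : ZMod M} {t : ℕ} (ht : 1 ≤ t) (ha : a.val = m * t) :
    m ≤ (Torus.cRepZ a).natAbs := by
  have hv : a.val < M := ZMod.val_lt a
  have htb : t < b := by
    by_contra h
    have h' : b ≤ t := not_lt.mp h
    have : b * m ≤ m * t := by nlinarith
    omega
  unfold Torus.cRepZ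
  split_ifs with h2
  · rw [ha, Int.natAbs_natCast]; nlinarith
  · rw [ha, hM]
    have : ((m * t : ℕ) : ℤ) - ((b * m : ℕ) : ℤ) = -((m * (b - t) : ℕ) : ℤ) := by
      have hle : t ≤ b := htb.le
      push_cast [Nat.cast_sub hle]
      ring
    rw [this, Int.natAbs_neg, Int.natAbs_natCast]
    have : 1 ≤ b - t := by omega
    nlinarith

omit [NeZero m] in
/-- **Windings are far**: a non-zero fine site in the kernel of the reduction has torus sup-distance `≥ m` from the origin
(`Torus.tnorm` = sup over coordinates of the centred representatives). [folklore] -/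
theorem le_tnorm_of_reduce_eq_zero (hM : M = b * m) {z : TorusSite d M}
    (hz : (fun i => (((z i).val : ℕ) : ZMod m)) = 0) (hz0 : z ≠ 0) : m ≤ Torus.tnorm z := by
  obtain ⟨i, t, ht, hval⟩ := exists_val_eq_mul_of_reduce_eq_zero hz hz0
  exact (le_natAbs_cRepZ_of_val_eq_mul hM ht hval).trans (Site.natAbs_le_supNorm (Torus.cRep z) i)

omit [NeZero m] in
/-- **The winding sum under a monotone decay weight**: if `Σ_z w(tnorm z)·‖F z‖ ≤ N` with `w` monotone and `0 < w m`, then the sum of `‖F‖` over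
the non-zero windings is at most `N / w m` — the finite-size error of §4 in terms of one weighted norm of the fine convolution. [folklore] -/
theorem sum_windings_norm_le_of_weighted (hM : M = b * m) (F : TorusSite d M → ℂ) {w : ℕ → ℝ} (hw : Monotone w) (hw0 : ∀ k, 0 ≤ w k)
    (hwm : 0 < w m) {N : ℝ} (hN : ∑ z : TorusSite d M, w (Torus.tnorm z) * ‖F z‖ ≤ N) :
    ∑ z ∈ (univ.filter (fun z : TorusSite d M => (fun i => (((z i).val : ℕ) : ZMod m)) = 0)).erase 0, ‖F z‖ ≤ N / w m := by
  classical
  rw [le_div_iff₀ hwm, Finset.sum_mul]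
  calc ∑ z ∈ (univ.filter (fun z : TorusSite d M => (fun i => (((z i).val : ℕ) : ZMod m)) = 0)).erase 0, ‖F z‖ * w m
      ≤ ∑ z ∈ (univ.filter (fun z : TorusSite d M => (fun i => (((z i).val : ℕ) : ZMod m)) = 0)).erase 0, w (Torus.tnorm z) * ‖F z‖ := by
        refine Finset.sum_le_sum fun z hz => ?_
        rw [mul_comm]
        have hz' := Finset.mem_erase.1 hz
        have hmem := (Finset.mem_filter.1 hz'.2).2
        exact mul_le_mul_of_nonneg_right (hw (le_tnorm_of_reduce_eq_zero hM hmem hz'.1)) (norm_nonneg _)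
    _ ≤ ∑ z : TorusSite d M, w (Torus.tnorm z) * ‖F z‖ :=
        Finset.sum_le_sum_of_subset_of_nonneg (fun z _ => Finset.mem_univ z) fun z _ _ => mul_nonneg (hw0 _) (norm_nonneg _)
    _ ≤ N := hN

/-- **§4 + §5: the two-volume loop error ≤ (weighted norm of the fine convolution) / w(m)** for any monotone non-negative weight with `w m > 0`.
[folklore] -/
theorem norm_coarse_loop_sub_fine_loop_le_of_weighted (hM : M = b * m) (A B : TorusSite d M → ℂ) {w : ℕ → ℝ} (hw : Monotone w)
    (hw0 : ∀ k, 0 ≤ w k) (hwm : 0 < w m) {N : ℝ}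
    (hN : ∑ z : TorusSite d M, w (Torus.tnorm z) * ‖∑ y, A y * B (z - y)‖ ≤ N) :
    ‖(∑ ybar : TorusSite d m,
        (∑ y ∈ univ.filter (fun y : TorusSite d M => (fun i => (((y i).val : ℕ) : ZMod m)) = ybar), A y) *
        ∑ w' ∈ univ.filter (fun w' : TorusSite d M => (fun i => (((w' i).val : ℕ) : ZMod m)) = -ybar), B w') -
      ∑ y, A y * B (-y)‖ ≤ N / w m :=
  (norm_coarse_loop_sub_fine_loop_le hM A B).trans (sum_windings_norm_le_of_weighted hM (fun z => ∑ y, A y * B (z - y)) hw hw0 hwm hN)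


/-! ## §6 The `torusFourier` (minus-sign) convention and the frame's position kernel `Ǩ_L = Per Ǩ_{bL}` -/

/-- `L^{-d}·torusFourier g y = conj (torusFourierInv (conj ∘ g) y)` — the two sign conventions differ by a conjugation. [folklore] -/
theorem inv_mul_torusFourier_eq_conj_torusFourierInv {L : ℕ} [NeZero L] (g : TorusSite d L → ℂ) (y : TorusSite d L) :
    ((L : ℂ) ^ d)⁻¹ * torusFourier g y = conj (torusFourierInv (fun k => conj (g k)) y) := by
  rw [torusFourier_eq_sum_torusChar, torusFourierInv_eq_sum_torusChar, map_mul, map_sum]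
  have hL : conj (((L : ℂ) ^ d)⁻¹) = ((L : ℂ) ^ d)⁻¹ := by
    rw [map_inv₀, map_pow, Complex.conj_natCast]
  rw [hL]
  congr 1
  refine Finset.sum_congr rfl fun k _ => ?_
  rw [map_mul, Complex.conj_conj, torusChar_comm]

/-- **Sampled-symbol kernels periodise exactly, `torusFourier` convention**: for `M = b·m` and any symbol `f`,
`Σ_{red y = x̄} M^{-d}·torusFourier (f ∘ p^{(M)}) y = m^{-d}·torusFourier (f ∘ p^{(m)}) x̄`. [folklore] -/
theorem periodise_torusFourier_sampled (hM : M = b * m) (f : (Fin d → ℝ) → ℂ) (xbar : TorusSite d m) :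
    ∑ y ∈ univ.filter (fun y : TorusSite d M => (fun i => (((y i).val : ℕ) : ZMod m)) = xbar),
        ((M : ℂ) ^ d)⁻¹ * torusFourier (fun k : TorusSite d M => f (latticeMomentum M k)) y =
      ((m : ℂ) ^ d)⁻¹ * torusFourier (fun k : TorusSite d m => f (latticeMomentum m k)) xbar := by
  simp_rw [inv_mul_torusFourier_eq_conj_torusFourierInv]
  rw [← map_sum, periodise_torusFourierInv_sampled hM (fun p => conj (f p)) xbar]

/-- **The frame's position kernel periodises exactly**: `Σ_{red y = x̄} Ǩ_{M}(y) = Ǩ_{m}(x̄)` for `M = b·m` and every `K : TrigPolyC4v`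
(`framePosKernel L K = L⁻²·(K ∘ p)^`, `FramePosKernelL1.framePosKernel_eq_torusFourier`) — the counterterm vertex of the coarse torus is the
periodisation of the fine one, with NO error. [folklore] -/
theorem periodise_framePosKernel {b m M : ℕ} [NeZero M] [NeZero m] (hM : M = b * m) (K : TrigPolyC4v) (xbar : TorusSite 2 m) :
    ∑ y ∈ univ.filter (fun y : TorusSite 2 M => (fun i => (((y i).val : ℕ) : ZMod m)) = xbar), framePosKernel M K y =
      framePosKernel m K xbar := by
  simp_rw [framePosKernel_eq_torusFourier]
  exact periodise_torusFourier_sampled hM (fun p => (K.eval p : ℂ)) xbar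


/-! ## §7 Periodisation does not increase weighted `ℓ¹` norms (the coarse torus distance of the reduction is at most the fine one) -/

/-- The reduction does not increase the torus sup-distance: `tnorm (red y) ≤ tnorm y` (minimality of centred representatives; `m ∣ M`). [folklore] -/
theorem tnorm_reduce_le (hM : M = b * m) (y : TorusSite d M) :
    Torus.tnorm (fun i => (((y i).val : ℕ) : ZMod m)) ≤ Torus.tnorm y := by
  unfold Torus.tnorm Site.supNorm
  refine Finset.sup_le fun i _ => ?_
  refine le_trans ?_ (Finset.le_sup (f := fun j => (Torus.cRep y j).natAbs) (Finset.mem_univ i))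
  show (Torus.cRepZ ((((y i).val : ℕ) : ZMod m))).natAbs ≤ (Torus.cRepZ (y i)).natAbs
  refine Torus.natAbs_cRepZ_le ?_
  -- `cRepZ (y i)` represents `red y i` modulo `m`
  have h := congr_fun (reduce_eq_castHom hM y) i
  rw [h, ← map_intCast (ZMod.castHom (dvd_of_eq_mul hM) (ZMod m)) (Torus.cRepZ (y i)), Torus.intCast_cRepZ]

/-- **Periodisation does not increase weighted `ℓ¹` norms**: for a weight monotone in the torus distance,
`Σ_{x̄} w(tnorm x̄)·‖Σ_{red y = x̄} g y‖ ≤ Σ_y w(tnorm y)·‖g y‖`. [folklore] -/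
theorem weighted_norm_periodise_le (hM : M = b * m) (g : TorusSite d M → ℂ) {w : ℕ → ℝ} (hw : Monotone w) (hw0 : ∀ k, 0 ≤ w k) :
    ∑ xbar : TorusSite d m, w (Torus.tnorm xbar) *
        ‖∑ y ∈ univ.filter (fun y : TorusSite d M => (fun i => (((y i).val : ℕ) : ZMod m)) = xbar), g y‖ ≤
      ∑ y : TorusSite d M, w (Torus.tnorm y) * ‖g y‖ := by
  classical
  calc ∑ xbar : TorusSite d m, w (Torus.tnorm xbar) *
          ‖∑ y ∈ univ.filter (fun y : TorusSite d M => (fun i => (((y i).val : ℕ) : ZMod m)) = xbar), g y‖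
      ≤ ∑ xbar : TorusSite d m, ∑ y ∈ univ.filter (fun y : TorusSite d M => (fun i => (((y i).val : ℕ) : ZMod m)) = xbar),
          w (Torus.tnorm y) * ‖g y‖ := by
        refine Finset.sum_le_sum fun xbar _ => ?_
        refine (mul_le_mul_of_nonneg_left (norm_sum_le _ _) (hw0 _)).trans ?_
        rw [Finset.mul_sum]
        refine Finset.sum_le_sum fun y hy => ?_
        have hred : (fun i => (((y i).val : ℕ) : ZMod m)) = xbar := (Finset.mem_filter.1 hy).2
        refine mul_le_mul_of_nonneg_right (hw ?_) (norm_nonneg _)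
        rw [← hred]
        exact tnorm_reduce_le hM y
    _ = ∑ y : TorusSite d M, w (Torus.tnorm y) * ‖g y‖ :=
        Finset.sum_fiberwise univ (fun y : TorusSite d M => (fun i => (((y i).val : ℕ) : ZMod m))) _

end Nested

end Summit.HubbardSuperconductivity.HubbardSuperconductivity.Theorems.TwoPointAssembly

end
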